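import Summits.CriticalPhenomena.PercolationContinuityZ3.Theses.PercLowPointHalfSpace
import Summits.CriticalPhenomena.PercolationContinuityZ3.Theorems.TallClusterMassBound.Negative.MassExponentFamily
import Summits.CriticalPhenomena.PercolationContinuityZ3.Theorems.TallClusterMassBound.Negative.FalseWithoutCriticality

/-!
# Line `replica-overlap-cs-transfer` — checked skeleton for crux `TallClusterMassBound`
(stmt-CriticalPhenomena-0912, route PercLowPointHalfSpace, item B; crux-plan round 1, gen 1 + gen-2 addenda)

Crux (by name): `Summit.CriticalPhenomena.PercolationContinuityZ3.Theses.PercLowPointHalfSpace.TallClusterMassBound`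
`= MassBoundAt p_c (11/4)` (`Negative.tallClusterMassBound_iff`, `Iff.rfl`):
`M(R) := Σ_{x ∈ B_R} P(0 ↔_ℍ x, arm_ℍ(0,R)) ≤ C R^{11/4} π_s(R)`, `π_s(R) := P(arm_ℍ(0,R))`, at `p_c(ℤ³)`.

IDEA (card `Ideas/replica-overlap-cs-transfer.md`): Cauchy–Schwarz is lossless for the wall-rooted
kernel, so B is an ℓ²/REPLICA-OVERLAP statement in disguise: `Σ_x P(·)² = E[|U ∩ U′ ∩ ·| ; U, U′ tall]`
for two independent copies `U, U′` of the half-space cluster of `0`.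

THIS SKELETON (2 registered stubs + a sorry-free composition). Cauchy–Schwarz is applied SHELL BY
SHELL (ℓ² inside each dyadic shell `B_n ∖ B_{n/2}`, ℓ¹ across shells); this confines the replica
content to the top shell of each scale and lowers the wall-arm regularity the transfer silently needs
from exponent `5/4` (global TSB/CSB, triage r1-2/r1-3) to `11/4` (the strength B′ itself embeds):

* `stub_topShellOverlap` (HARDEST; the conjunct-strength kernel, "x_h ≥ 1/4" in conditional top-shell
  ℓ² form): `Σ_{x ∈ B_n ∖ B_{⌊n/2⌋}} P(0 ↔_ℍ x, arm_n)² ≤ C n^{5/2} π_s(n)²` — the expected overlap, on the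
  top shell, of two INDEPENDENT n-tall wall clusters is `≤ C n^{5/2} π_s(n)²` (heuristic value
  `n^{3-2x_h} π_s² ≈ n^{2.05} π_s²`, margin `0.45`; MC ovl_talltall slopes 2.0–2.2, card). Uses `p ≤ p_c`.
* `stub_wallArmLowerRegularity` (two-scale LOWER regularity of the wall one-arm, "x_s < 11/4"):
  `π_s(n) ≤ C (r/n)^λ π_s(r)` for `1 ≤ n ≤ r`, some `λ < 11/4` (heuristic `λ = x_s ≈ 0.975`, margin 1.77;
  MC doubling ratio `π_s(2n)/π_s(n) ≈ 0.515 ≫ 2^{-11/4} = 0.149`, kit j007379). Uses `p ≥ p_c`.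
* `TallClusterMassBound_of` (PROVED from the two stubs, no sorry): dyadic partition
  `B_R = {0} ∪ ⋃_i (B_{R/2^i} ∖ B_{R/2^{i+1}})`, `arm_R ⊆ arm_n` on shell `n = R/2^i`, Cauchy–Schwarz on the
  shell (`(Σ f)² ≤ 27 n³ Σ f²`) ⇒ shell mass `≤ K n^{11/4} π_s(n) ≤ K C (n/R)^{11/4-λ} R^{11/4} π_s(R)`,
  geometric series in `i`.

Proved remarks (documentation of the exchange rate; not stubs): `topShellOverlap_of_condOverlap`
(CSB ⇒ stub 1: the conditional surface bubble of triage r1-2 implies the top-shell statement),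
`condOverlap_of_truncatedSurfaceBubble` (TSB ⇒ CSB), `massBoundAt_of_condOverlap`
(CSB alone ⇒ `MassBoundAt p_c (11/4)`, the card's `tsb_implies_crux` in conditional form, stated on
`MassBoundAt` so that exactly ONE theorem of this file concludes the crux by name).
Gen-2 addenda (crux-plan gen 2, proved, no new stub; section "Gen-2 addenda" at the end):
`wallArmLowerRegularity_of_doubling` (a uniform per-dyadic-scale extension constant
`π_s(2n) ≥ q₀ π_s(n)`, `n ≥ n₀`, with `q₀ > 2^{-11/4} ≈ 0.149` gives stub 2 — MC ratio 0.51–0.59),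
`massBoundAt_of_topShell_of_dyadicSum` (the weakest, AVERAGED cross-scale input the composition
consumes), the regularity-free two-scale variant (T) `TwoScaleShellOverlap` with
`massBoundAt_of_twoScaleShellOverlap` ((T) alone ⇒ crux; its lower shells carry the cross-scale
content instead of stub 2) and `twoScaleShellOverlap_false_at_one`.

DISPROOF USED (Cruxes/TallClusterMassBound/Disproof.lean, cdisprove gen 1; landed Negative modules
imported above): `tallClusterMassBound_false_without_criticality` (¬MassBoundAt 1 (11/4): a proof must
use `p ≤ p_c` quantitatively) is honoured at `stub_topShellOverlap` — at `p = 1` its LHS is `≥ c n³`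
(`real_conn_inter_arm_one`) against `C n^{5/2}`, so the stub is false without criticality, exactly as
the crux; `stub_wallArmLowerRegularity` is where `p ≥ p_c` enters (it is trivially true at `p = 1`,
`armProb 1 n = 1`, and false for `p < p_c` by sharpness). `not_densityBoundAt_criticalProbI` (no uniform
density bound; `ρ_r(0) = 1`): both stubs are AVERAGED statements and stub 1 has NO root term
(`0 ∉ annulus`). `succ_mul_armProb_le_mass` / `not_massBoundAt_criticalProbI_of_lt_one` (m ≥ 1):
respected (we certify `m ≤ 11/4` only through the stubs). `-- Targets`: none at gen 1.
Negatives index (8 refuted statements of the summit): none is an ℓ²/overlap or wall-arm-regularity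
statement (triage r1-1/2/3 concur).
-/

noncomputable section

open MeasureTheory Finset Filter
open Literature.Probability.Percolation Literature.Probability.LatticeModels
open Summit.CriticalPhenomena.PercolationContinuityZ3.Theses.PercLowPointHalfSpace (TallClusterMassBound)
open Summit.CriticalPhenomena.PercolationContinuityZ3.Theorems.TallClusterMassBound.Negative

namespace Summit.CriticalPhenomena.PercolationContinuityZ3.Cruxes.TallClusterMassBound.ReplicaOverlapCsTransfer

/-! ## The two registered stubs

Vocabulary (landed, importable, sorry-free: `Theorems/TallClusterMassBound/Negative/MassExponentFamily.lean`):
`Pp p = bondPercolation (zdGraph 3) p`, `conn x = openConnIn {x | 0 ≤ x 0} 0 x` (`0 ↔_ℍ x`),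
`arm n = {ω | ∃ y, (∃ i, n ≤ |y i|) ∧ ω ∈ openConnIn {x | 0 ≤ x 0} 0 y}` (`arm_ℍ(0,n)`, verbatim the route's
tall event), `armProb p n = (Pp p).real (arm n)` (`π_s(n)`), `mass p R = Σ_{x ∈ box 3 R} (Pp p).real (conn x ∩ arm R)`,
`MassBoundAt p s`; `annulus 3 r R = box 3 R \ box 3 r` (`Literature.Probability.LatticeModels.annulus`). -/

/-- **STUB 1 (hardest) — top-shell conditional replica overlap.** At `p_c(ℤ³)`, for every `n ≥ 1`,
`Σ_{x ∈ B_n ∖ B_{⌊n/2⌋}} P(0 ↔_ℍ x ∧ arm_ℍ(0,n))² ≤ C n^{5/2} P(arm_ℍ(0,n))²`,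
i.e. `E[|U ∩ U′ ∩ (B_n ∖ B_{n/2})| ; U and U′ both n-tall] ≤ C n^{5/2} π_s(n)²` for two INDEPENDENT copies
`U, U′` of the half-space cluster of the wall point `0`.
Why plausibly true: conditional density `ρ_n(x) ≍ n^{-x_h} g(x₀/n)` on the top shell gives
`LHS ≍ n^{3-2x_h} π_s(n)² ≈ n^{2.05} π_s(n)²` (`x_h = 3 - d_f ≈ 0.477`), margin `0.45` in the exponent
(the card's "double margin"); MC (card, mc_tall.py; kit j009137): overlap-given-both-tall slopes 1.92–2.18
at `n ≤ 48`. It is the conjunct-strength part of B (Disproof §8.4(b)) in half-space ℓ² form: violated in a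
jump world (dense wall clusters: LHS `≍ n³ π_s²`), false at `p = 1`, false for the `d = 2` analogue
(`2 - 2·(5/48) > 3/2`) — so no dimension-free or criticality-free proof exists (Disproof §8.4(a),(d)).
Implied by CSB (`topShellOverlap_of_condOverlap`), hence by TSB. NOT summit-costume: a bound on
`P(0 ↔_ℍ x, ·)` has no `θ²` lower bound (BGN: `θ_ℍ(p_c) = 0` in every world). Size: XL (open). -/
theorem stub_topShellOverlap :
    ∃ C : ℝ, ∀ n : ℕ, 1 ≤ n →
      ∑ x ∈ annulus 3 (n / 2) n, ((Pp (criticalProbI 3)).real (conn x ∩ arm n)) ^ 2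
        ≤ C * (n : ℝ) ^ ((5 : ℝ) / 2) * (armProb (criticalProbI 3) n) ^ 2 := by
  sorry

/-- **STUB 2 — two-scale lower regularity of the wall one-arm (exponent `< 11/4`).** At `p_c(ℤ³)`
there are `C` and `λ < 11/4` with `π_s(n) ≤ C (r/n)^λ π_s(r)` for all `1 ≤ n ≤ r`, i.e.
`π_s(r) ≥ C⁻¹ (n/r)^λ π_s(n)`: halving the scale costs at most a bounded factor `< 2^{11/4}` in wall-arm
probability, uniformly. Why plausibly true: `π_s(r)/π_s(n) ≍ (n/r)^{x_s}`, `x_s ≈ 0.975` (Deng–Blöte 2005,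
doi:10.1103/PhysRevE.71.016117), margin `1.77`; MC doubling ratio `π_s(2n)/π_s(n) ≈ 0.515 ≫ 2^{-11/4} ≈ 0.149`
(kit j007379, quarter-arm card; this line's own mc_local_results: `P_tall` slopes −0.9…−1.2). It is the
regularity input Disproof §8.4(c) isolates ("a-priori polynomial regularity `π_ℍ(r) ≥ c (k/r)^λ π_ℍ(k)`"),
here with the WEAKEST exponent any version of this line can use (global TSB needs `λ < 5/4`, triage r1-2
`tsb_forces_wallArm_lower`; B′ needs `x_s ≤ 11/4`, `uncond_forces_wallArm_lower`). In particular (n = 1) it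
contains the one-scale lower bound `π_s(r) ≥ c r^{-λ}`; provable today only with exponent 4
(`BoundaryArmPolyLower`, SketchIdeator2). Uses `p ≥ p_c` (false for `p < p_c` by sharpness; trivially true
at `p = 1`); with the literal exponent `11/4` it fails in `d > 6` (`x_s = 3`, Chatterjee–Hanson arXiv:1810.03750),
while its d-scaled form (exponent `d - 1/4`) is believed in every `d` (2D: boundary exponent `1/3`, RSW-provable) —
the line's obligatory `d = 2` failure (Disproof §8.4(d)) sits in stub 1, not here.
Not summit-costume (a LOWER bound on connection probabilities). Size: L–XL (open; 2D analogue = RSW). -/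
theorem stub_wallArmLowerRegularity :
    ∃ C lam : ℝ, lam < (11 : ℝ) / 4 ∧ ∀ n r : ℕ, 1 ≤ n → n ≤ r →
      armProb (criticalProbI 3) n ≤ C * ((r : ℝ) / n) ^ lam * armProb (criticalProbI 3) r := by
  sorry

/-! ## Elementary lemmas for the composition (all proved) -/

/-- Taller is rarer: `arm R ⊆ arm n` for `n ≤ R`. -/
theorem arm_antitone {n R : ℕ} (h : n ≤ R) : arm R ⊆ arm n := by
  rintro ω ⟨y, ⟨i, hi⟩, hy⟩
  exact ⟨y, ⟨i, le_trans (by exact_mod_cast h) hi⟩, hy⟩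

/-- `P(0 ↔_ℍ x, arm_R) ≤ P(0 ↔_ℍ x, arm_n)` for `n ≤ R`. -/
theorem real_conn_inter_arm_mono (p : unitInterval) (x : V3) {n R : ℕ} (h : n ≤ R) :
    (Pp p).real (conn x ∩ arm R) ≤ (Pp p).real (conn x ∩ arm n) :=
  measureReal_mono (Set.inter_subset_inter_right _ (arm_antitone h))

/-- The root term of the mass: `P(0 ↔_ℍ 0, arm_R) = π(R)`. -/
theorem real_conn_zero_inter_arm (p : unitInterval) (R : ℕ) :
    (Pp p).real (conn 0 ∩ arm R) = armProb p R := by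
  rw [conn_zero, Set.univ_inter]; rfl

/-- `box 3 0 = {0}`. -/
theorem box_three_zero : box 3 0 = {0} := by
  ext x
  simp only [mem_box, Nat.cast_zero, neg_zero, Finset.mem_singleton]
  constructor
  · intro h
    funext i
    exact le_antisymm (h i).2 (h i).1
  · rintro rfl i
    simp

/-- Iterated halving: `R / 2^i / 2 = R / 2^(i+1)`. -/
theorem div_two_pow_succ (R i : ℕ) : R / 2 ^ i / 2 = R / 2 ^ (i + 1) := by
  rw [Nat.div_div_eq_div_mul, pow_succ]

/-- DYADIC PARTITION of a box sum: peel the top shells `B_{R/2^i} ∖ B_{R/2^{i+1}}`, `i < N`. -/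
theorem sum_box_dyadic (g : V3 → ℝ) (R : ℕ) : ∀ N : ℕ,
    ∑ x ∈ box 3 R, g x = ∑ x ∈ box 3 (R / 2 ^ N), g x +
      ∑ i ∈ Finset.range N, ∑ x ∈ annulus 3 (R / 2 ^ (i + 1)) (R / 2 ^ i), g x
  | 0 => by simp
  | N + 1 => by
    rw [Finset.sum_range_succ, sum_box_dyadic g R N]
    have hsub : box 3 (R / 2 ^ (N + 1)) ⊆ box 3 (R / 2 ^ N) := by
      refine box_mono 3 ?_
      rw [← div_two_pow_succ]
      exact Nat.div_le_self _ _
    have hsplit := Finset.sum_sdiff hsub (f := g)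
    rw [annulus]
    linarith

/-- The dyadic partition down to the root: `Σ_{B_R} g = g 0 + Σ_{i<R} Σ_{B_{R/2^i} ∖ B_{R/2^{i+1}}} g`. -/
theorem sum_box_eq_root_add_shells (g : V3 → ℝ) (R : ℕ) :
    ∑ x ∈ box 3 R, g x = g 0 +
      ∑ i ∈ Finset.range R, ∑ x ∈ annulus 3 (R / 2 ^ (i + 1)) (R / 2 ^ i), g x := by
  have h := sum_box_dyadic g R R
  have h0 : R / 2 ^ R = 0 := Nat.div_eq_of_lt (Nat.lt_two_pow_self)
  rw [h0, box_three_zero, Finset.sum_singleton] at h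
  exact h

/-- A shell has at most `27 n³` points. -/
theorem card_annulus_le (m n : ℕ) (hn : 1 ≤ n) : (#(annulus 3 m n) : ℝ) ≤ 27 * (n : ℝ) ^ 3 := by
  have h1 : #(annulus 3 m n) ≤ #(box 3 n) := Finset.card_le_card Finset.sdiff_subset
  have h2 : (#(annulus 3 m n) : ℝ) ≤ (#(box 3 n) : ℝ) := by exact_mod_cast h1
  refine h2.trans ?_
  rw [card_box]
  push_cast
  have h1' : (1 : ℝ) ≤ n := by exact_mod_cast hn
  have hr0 : (0 : ℝ) < n := by linarith
  nlinarith [h1', sq_nonneg ((n : ℝ) - 1), mul_pos hr0 hr0]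

/-- SHELL-WISE CAUCHY–SCHWARZ (ℓ² → ℓ¹ on one shell, no exponent loss): a top-shell overlap bound
`Σ_{shell} f² ≤ C n^{5/2} π²` gives the shell mass bound `Σ_{shell} f ≤ √(27 C⁺) n^{11/4} π`. -/
theorem shell_mass_le_of_overlap {C : ℝ} {n : ℕ} (hn : 1 ≤ n) {s : Finset V3}
    (hs : (#s : ℝ) ≤ 27 * (n : ℝ) ^ 3) {f : V3 → ℝ} (hf : ∀ x, 0 ≤ f x) {P : ℝ} (hP : 0 ≤ P)
    (h : ∑ x ∈ s, (f x) ^ 2 ≤ C * (n : ℝ) ^ ((5 : ℝ) / 2) * P ^ 2) :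
    ∑ x ∈ s, f x ≤ Real.sqrt (27 * max C 0) * (n : ℝ) ^ ((11 : ℝ) / 4) * P := by
  have hr0 : (0 : ℝ) < n := by exact_mod_cast hn
  set A : ℝ := ∑ x ∈ s, f x with hA
  have hA0 : 0 ≤ A := Finset.sum_nonneg fun x _ => hf x
  have hCS : A ^ 2 ≤ (∑ x ∈ s, (f x) ^ 2) * (#s : ℝ) := by
    have h := Finset.sum_mul_sq_le_sq_mul_sq s (fun x => f x) (fun _ => (1 : ℝ))
    simpa [hA] using h
  have hmax : 0 ≤ max C 0 := le_max_right _ _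
  have hsum : ∑ x ∈ s, (f x) ^ 2 ≤ max C 0 * (n : ℝ) ^ ((5 : ℝ) / 2) * P ^ 2 := by
    refine le_trans h ?_
    have : C ≤ max C 0 := le_max_left _ _
    have hnn : 0 ≤ (n : ℝ) ^ ((5 : ℝ) / 2) * P ^ 2 := by positivity
    nlinarith [mul_le_mul_of_nonneg_right this hnn]
  have h3 : (n : ℝ) ^ (3 : ℝ) = (n : ℝ) ^ 3 := by
    rw [show (3 : ℝ) = ((3 : ℕ) : ℝ) by norm_num, Real.rpow_natCast]
  have hpow : ((n : ℝ) ^ ((11 : ℝ) / 4)) ^ 2 = (n : ℝ) ^ ((5 : ℝ) / 2) * (n : ℝ) ^ 3 := by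
    rw [← h3, ← Real.rpow_add hr0, ← Real.rpow_natCast, ← Real.rpow_mul hr0.le]
    congr 1
    push_cast
    norm_num
  have hsq : (Real.sqrt (27 * max C 0)) ^ 2 = 27 * max C 0 := Real.sq_sqrt (by positivity)
  have hsnn : 0 ≤ ∑ x ∈ s, (f x) ^ 2 := Finset.sum_nonneg fun x _ => sq_nonneg _
  have hB : A ^ 2 ≤ (Real.sqrt (27 * max C 0) * (n : ℝ) ^ ((11 : ℝ) / 4) * P) ^ 2 := by
    calc A ^ 2 ≤ (∑ x ∈ s, (f x) ^ 2) * (#s : ℝ) := hCS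
      _ ≤ (max C 0 * (n : ℝ) ^ ((5 : ℝ) / 2) * P ^ 2) * (27 * (n : ℝ) ^ 3) :=
          mul_le_mul hsum hs (by positivity) (mul_nonneg (mul_nonneg hmax (by positivity)) (sq_nonneg _))
      _ = (Real.sqrt (27 * max C 0) * (n : ℝ) ^ ((11 : ℝ) / 4) * P) ^ 2 := by
          rw [mul_pow, mul_pow, hsq, hpow]; ring
  have hBnonneg : 0 ≤ Real.sqrt (27 * max C 0) * (n : ℝ) ^ ((11 : ℝ) / 4) * P := by positivity
  exact (pow_le_pow_iff_left₀ hA0 hBnonneg (by norm_num : (2 : ℕ) ≠ 0)).1 hB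

/-- Exponent bookkeeping: `n^{11/4} (R/n)^λ = (n/R)^{11/4-λ} R^{11/4}` for `0 < n`, `0 < R`. -/
theorem scale_identity {n R lam : ℝ} (hn : 0 < n) (hR : 0 < R) :
    n ^ ((11 : ℝ) / 4) * (R / n) ^ lam = (n / R) ^ ((11 : ℝ) / 4 - lam) * R ^ ((11 : ℝ) / 4) := by
  have h1 : (0 : ℝ) < n ^ lam := Real.rpow_pos_of_pos hn lam
  have h2 : (0 : ℝ) < R ^ lam := Real.rpow_pos_of_pos hR lam
  have h3 : (0 : ℝ) < R ^ ((11 : ℝ) / 4) := Real.rpow_pos_of_pos hR _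
  have h4 : (0 : ℝ) < n ^ ((11 : ℝ) / 4) := Real.rpow_pos_of_pos hn _
  rw [Real.div_rpow hR.le hn.le, Real.div_rpow hn.le hR.le, Real.rpow_sub hn, Real.rpow_sub hR]
  field_simp

/-- Dyadic decay of the scale factor: for the `i`-th shell radius `n = R / 2^i ≥ 1`,
`(n/R)^δ ≤ ((2^δ)⁻¹)^i` (`δ ≥ 0`). -/
theorem scale_factor_le {R i : ℕ} {δ : ℝ} (hδ : 0 ≤ δ) (hR : 1 ≤ R) :
    (((R / 2 ^ i : ℕ) : ℝ) / R) ^ δ ≤ (((2 : ℝ) ^ δ)⁻¹) ^ i := by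
  have hR0 : (0 : ℝ) < R := by exact_mod_cast hR
  have hle : (((R / 2 ^ i : ℕ) : ℝ) / R) ≤ ((2 : ℝ) ^ i)⁻¹ := by
    have h1 : ((R / 2 ^ i : ℕ) : ℝ) ≤ (R : ℝ) / (2 : ℝ) ^ i := by
      have := Nat.cast_div_le (α := ℝ) (m := R) (n := 2 ^ i)
      push_cast at this
      exact this
    rw [div_le_iff₀ hR0]
    calc ((R / 2 ^ i : ℕ) : ℝ) ≤ (R : ℝ) / (2 : ℝ) ^ i := h1
      _ = ((2 : ℝ) ^ i)⁻¹ * R := by ring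
  have hnn : 0 ≤ (((R / 2 ^ i : ℕ) : ℝ) / R) := by positivity
  calc (((R / 2 ^ i : ℕ) : ℝ) / R) ^ δ ≤ (((2 : ℝ) ^ i)⁻¹) ^ δ := Real.rpow_le_rpow hnn hle hδ
    _ = (((2 : ℝ) ^ i) ^ δ)⁻¹ := Real.inv_rpow (by positivity) δ
    _ = (((2 : ℝ) ^ δ) ^ i)⁻¹ := by
        congr 1
        rw [← Real.rpow_natCast (2 : ℝ) i, ← Real.rpow_mul (by norm_num), mul_comm,
          Real.rpow_mul (by norm_num), Real.rpow_natCast]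
    _ = (((2 : ℝ) ^ δ)⁻¹) ^ i := by rw [inv_pow]

/-! ## The composition: the two stubs imply the crux, by name -/

/-- **THE LINE, with its two inputs as explicit hypotheses** (pure bookkeeping, proved):
top-shell overlap bound + two-scale wall-arm regularity with `λ < 11/4` ⇒ `MassBoundAt p_c (11/4)`.
(Stated on `MassBoundAt` — `Iff.rfl`-equal to the crux — so that `TallClusterMassBound_of` below is the
only theorem of this file whose conclusion is the crux decl itself.) -/
theorem massBoundAt_of_topShell_of_regularity {CF CW lam : ℝ}
    (hF : ∀ n : ℕ, 1 ≤ n →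
      ∑ x ∈ annulus 3 (n / 2) n, ((Pp (criticalProbI 3)).real (conn x ∩ arm n)) ^ 2
        ≤ CF * (n : ℝ) ^ ((5 : ℝ) / 2) * (armProb (criticalProbI 3) n) ^ 2)
    (hlam : lam < (11 : ℝ) / 4)
    (hW : ∀ n r : ℕ, 1 ≤ n → n ≤ r →
      armProb (criticalProbI 3) n ≤ CW * ((r : ℝ) / n) ^ lam * armProb (criticalProbI 3) r) :
    MassBoundAt (criticalProbI 3) ((11 : ℝ) / 4) := by
  set p : unitInterval := criticalProbI 3 with hp
  set K : ℝ := Real.sqrt (27 * max CF 0) with hK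
  set δ : ℝ := (11 : ℝ) / 4 - lam with hδdef
  have hδ : 0 < δ := by rw [hδdef]; linarith
  set q : ℝ := ((2 : ℝ) ^ δ)⁻¹ with hq
  have hq1 : q < 1 := inv_lt_one_of_one_lt₀ (Real.one_lt_rpow (by norm_num) hδ)
  have hq0 : 0 ≤ q := by positivity
  have hK0 : 0 ≤ K := Real.sqrt_nonneg _
  -- CW is forced positive-ish; we only need `max CW 0`
  set CW' : ℝ := max CW 0 with hCW'
  have hCW'0 : 0 ≤ CW' := le_max_right _ _
  refine ⟨1 + K * CW' * (1 - q)⁻¹, fun R hR => ?_⟩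
  have hR0 : (0 : ℝ) < R := by exact_mod_cast hR
  have hπR := armProb_nonneg p R
  -- (1) the shell bound at tallness R, for the shell of radius n = R / 2^i
  have shell : ∀ i : ℕ, ∑ x ∈ annulus 3 (R / 2 ^ (i + 1)) (R / 2 ^ i), (Pp p).real (conn x ∩ arm R)
      ≤ K * CW' * q ^ i * ((R : ℝ) ^ ((11 : ℝ) / 4) * armProb p R) := by
    intro i
    set n : ℕ := R / 2 ^ i with hn
    have hrhs0 : 0 ≤ K * CW' * q ^ i * ((R : ℝ) ^ ((11 : ℝ) / 4) * armProb p R) := by positivity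
    rcases Nat.eq_zero_or_pos n with hn0 | hnpos
    · -- empty shell
      have hn1 : R / 2 ^ (i + 1) = 0 := by
        rw [← div_two_pow_succ, ← hn, hn0]
      rw [hn1, hn0]
      simp only [annulus, sdiff_self, Finset.bot_eq_empty, Finset.sum_empty]
      exact hrhs0
    · have hn1 : 1 ≤ n := hnpos
      have hnR : n ≤ R := Nat.div_le_self _ _
      have hn0r : (0 : ℝ) < n := by exact_mod_cast hn1
      have hπn := armProb_nonneg p n
      -- tallness R ≤ tallness n on the shell, then Cauchy–Schwarz on the shell
      have step1 : ∑ x ∈ annulus 3 (R / 2 ^ (i + 1)) (R / 2 ^ i), (Pp p).real (conn x ∩ arm R)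
          ≤ ∑ x ∈ annulus 3 (n / 2) n, (Pp p).real (conn x ∩ arm n) := by
        rw [← div_two_pow_succ, ← hn]
        exact Finset.sum_le_sum fun x _ => real_conn_inter_arm_mono p x hnR
      have step2 : ∑ x ∈ annulus 3 (n / 2) n, (Pp p).real (conn x ∩ arm n)
          ≤ K * (n : ℝ) ^ ((11 : ℝ) / 4) * armProb p n :=
        shell_mass_le_of_overlap hn1 (card_annulus_le _ _ hn1) (fun _ => measureReal_nonneg) hπn (hF n hn1)
      -- wall-arm regularity climbs back from π(n) to π(R)
      have step3 : (n : ℝ) ^ ((11 : ℝ) / 4) * armProb p n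
          ≤ CW' * q ^ i * ((R : ℝ) ^ ((11 : ℝ) / 4) * armProb p R) := by
        have hw := hW n R hn1 hnR
        have hfac0 : 0 ≤ ((R : ℝ) / n) ^ lam := by positivity
        have hw' : armProb p n ≤ CW' * ((R : ℝ) / n) ^ lam * armProb p R :=
          hw.trans (mul_le_mul_of_nonneg_right (mul_le_mul_of_nonneg_right (le_max_left _ _) hfac0) hπR)
        have hid := scale_identity (lam := lam) hn0r hR0
        have hsf : ((n : ℝ) / R) ^ δ ≤ q ^ i := by
          have := scale_factor_le (i := i) hδ.le hR
          rwa [← hn] at this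
        calc (n : ℝ) ^ ((11 : ℝ) / 4) * armProb p n
            ≤ (n : ℝ) ^ ((11 : ℝ) / 4) * (CW' * ((R : ℝ) / n) ^ lam * armProb p R) :=
              mul_le_mul_of_nonneg_left hw' (by positivity)
          _ = CW' * ((n : ℝ) ^ ((11 : ℝ) / 4) * ((R : ℝ) / n) ^ lam) * armProb p R := by ring
          _ = CW' * (((n : ℝ) / R) ^ δ * (R : ℝ) ^ ((11 : ℝ) / 4)) * armProb p R := by rw [hid]
          _ ≤ CW' * (q ^ i * (R : ℝ) ^ ((11 : ℝ) / 4)) * armProb p R := by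
              have hRp : 0 ≤ (R : ℝ) ^ ((11 : ℝ) / 4) := by positivity
              exact mul_le_mul_of_nonneg_right
                (mul_le_mul_of_nonneg_left (mul_le_mul_of_nonneg_right hsf hRp) hCW'0) hπR
          _ = CW' * q ^ i * ((R : ℝ) ^ ((11 : ℝ) / 4) * armProb p R) := by ring
      calc ∑ x ∈ annulus 3 (R / 2 ^ (i + 1)) (R / 2 ^ i), (Pp p).real (conn x ∩ arm R)
          ≤ K * (n : ℝ) ^ ((11 : ℝ) / 4) * armProb p n := step1.trans step2
        _ = K * ((n : ℝ) ^ ((11 : ℝ) / 4) * armProb p n) := by ring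
        _ ≤ K * (CW' * q ^ i * ((R : ℝ) ^ ((11 : ℝ) / 4) * armProb p R)) :=
            mul_le_mul_of_nonneg_left step3 hK0
        _ = K * CW' * q ^ i * ((R : ℝ) ^ ((11 : ℝ) / 4) * armProb p R) := by ring
  -- (2) geometric series over the shells
  have geom : ∑ i ∈ Finset.range R, q ^ i ≤ (1 - q)⁻¹ := by
    have hs : Summable fun i : ℕ => q ^ i := summable_geometric_of_lt_one hq0 hq1
    calc ∑ i ∈ Finset.range R, q ^ i ≤ ∑' i : ℕ, q ^ i :=
          hs.sum_le_tsum (Finset.range R) fun i _ => pow_nonneg hq0 i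
      _ = (1 - q)⁻¹ := tsum_geometric_of_lt_one hq0 hq1
  -- (3) assemble: mass = root + shells
  have hmass : mass p R = (Pp p).real (conn 0 ∩ arm R) +
      ∑ i ∈ Finset.range R, ∑ x ∈ annulus 3 (R / 2 ^ (i + 1)) (R / 2 ^ i), (Pp p).real (conn x ∩ arm R) :=
    sum_box_eq_root_add_shells (fun x => (Pp p).real (conn x ∩ arm R)) R
  have hroot : (Pp p).real (conn 0 ∩ arm R) = armProb p R := real_conn_zero_inter_arm p R
  have hRpow1 : (1 : ℝ) ≤ (R : ℝ) ^ ((11 : ℝ) / 4) := Real.one_le_rpow (by exact_mod_cast hR) (by norm_num)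
  have hX0 : 0 ≤ (R : ℝ) ^ ((11 : ℝ) / 4) * armProb p R := by positivity
  calc mass p R
      = armProb p R + ∑ i ∈ Finset.range R,
          ∑ x ∈ annulus 3 (R / 2 ^ (i + 1)) (R / 2 ^ i), (Pp p).real (conn x ∩ arm R) := by rw [hmass, hroot]
    _ ≤ armProb p R + ∑ i ∈ Finset.range R, K * CW' * q ^ i * ((R : ℝ) ^ ((11 : ℝ) / 4) * armProb p R) :=
        add_le_add le_rfl (Finset.sum_le_sum fun i _ => shell i)
    _ = armProb p R + K * CW' * (∑ i ∈ Finset.range R, q ^ i) * ((R : ℝ) ^ ((11 : ℝ) / 4) * armProb p R) := by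
        rw [Finset.mul_sum, Finset.sum_mul]
    _ ≤ (R : ℝ) ^ ((11 : ℝ) / 4) * armProb p R
          + K * CW' * (1 - q)⁻¹ * ((R : ℝ) ^ ((11 : ℝ) / 4) * armProb p R) := by
        refine add_le_add ?_ ?_
        · simpa using mul_le_mul_of_nonneg_right hRpow1 hπR
        · exact mul_le_mul_of_nonneg_right (mul_le_mul_of_nonneg_left geom (by positivity)) hX0
    _ = (1 + K * CW' * (1 - q)⁻¹) * (R : ℝ) ^ ((11 : ℝ) / 4) * armProb p R := by ring

/-- **COMPOSITION (kernel-checked modulo the two stubs): `stub_topShellOverlap` and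
`stub_wallArmLowerRegularity` imply the crux `TallClusterMassBound`, concluded BY NAME.**
`M(R) = π(R) + Σ_{i<R} Σ_{B_{R/2^i} ∖ B_{R/2^{i+1}}} P(0 ↔_ℍ x, arm_R)`; on the shell of radius
`n = R/2^i`: `arm_R ⊆ arm_n`, Cauchy–Schwarz with stub 1 gives `≤ √(27 C_F) n^{11/4} π(n)`, stub 2 gives
`n^{11/4} π(n) ≤ C_W (n/R)^{11/4-λ} R^{11/4} π(R) ≤ C_W 2^{-iδ} R^{11/4} π(R)`; sum the geometric series. -/
theorem TallClusterMassBound_of : TallClusterMassBound := by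
  obtain ⟨CF, hF⟩ := stub_topShellOverlap
  obtain ⟨CW, lam, hlam, hW⟩ := stub_wallArmLowerRegularity
  exact tallClusterMassBound_iff.2 (massBoundAt_of_topShell_of_regularity hF hlam hW)

/-! ## Proved remarks: where the stubs sit relative to the card's TSB / triage's CSB -/

/-- CSB, the CONDITIONAL surface bubble / replica overlap over the whole box (triage r1-2's repaired
transfer target; the card's kit observable `ovl_talltall`):
`Σ_{x ∈ B_n} P(0 ↔_ℍ x, arm_n)² ≤ C n^{5/2} π_s(n)²`. [folklore] -/
def CondOverlap : Prop :=
  ∃ C : ℝ, ∀ n : ℕ, 1 ≤ n →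
    ∑ x ∈ box 3 n, ((Pp (criticalProbI 3)).real (conn x ∩ arm n)) ^ 2
      ≤ C * (n : ℝ) ^ ((5 : ℝ) / 2) * (armProb (criticalProbI 3) n) ^ 2

/-- TSB, the card's UNCONDITIONAL truncated surface bubble `Σ_{x ∈ B_n} τ_ℍ(0,x)² ≤ C n^{5/2} π_s(n)²`
(contains the root-term lower bound `π_s(n) ≥ C^{-1/2} n^{-5/4}`, triage r1-2/r1-3). [folklore] -/
def TruncatedSurfaceBubble : Prop :=
  ∃ C : ℝ, ∀ n : ℕ, 1 ≤ n →
    ∑ x ∈ box 3 n, ((Pp (criticalProbI 3)).real (conn x)) ^ 2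
      ≤ C * (n : ℝ) ^ ((5 : ℝ) / 2) * (armProb (criticalProbI 3) n) ^ 2

/-- CSB ⇒ stub 1's statement (the top shell is part of the box): stub 1 is WEAKER than CSB. -/
theorem topShellOverlap_of_condOverlap (h : CondOverlap) :
    ∃ C : ℝ, ∀ n : ℕ, 1 ≤ n →
      ∑ x ∈ annulus 3 (n / 2) n, ((Pp (criticalProbI 3)).real (conn x ∩ arm n)) ^ 2
        ≤ C * (n : ℝ) ^ ((5 : ℝ) / 2) * (armProb (criticalProbI 3) n) ^ 2 := by
  obtain ⟨C, hC⟩ := h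
  refine ⟨C, fun n hn => le_trans ?_ (hC n hn)⟩
  exact Finset.sum_le_sum_of_subset_of_nonneg (by rw [annulus]; exact Finset.sdiff_subset)
    fun _ _ _ => sq_nonneg _

/-- TSB ⇒ CSB (drop the conditioning termwise): CSB is WEAKER than TSB. -/
theorem condOverlap_of_truncatedSurfaceBubble (h : TruncatedSurfaceBubble) : CondOverlap := by
  obtain ⟨C, hC⟩ := h
  refine ⟨C, fun n hn => le_trans (Finset.sum_le_sum fun x _ => ?_) (hC n hn)⟩
  have h1 : (Pp (criticalProbI 3)).real (conn x ∩ arm n) ≤ (Pp (criticalProbI 3)).real (conn x) :=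
    measureReal_mono Set.inter_subset_left
  exact pow_le_pow_left₀ measureReal_nonneg h1 2

/-- CSB alone ⇒ `MassBoundAt p_c (11/4)` (= the crux, `tallClusterMassBound_iff`) by ONE global
Cauchy–Schwarz — the card's transfer in conditional form (triage r1-2 `csb_implies_crux`, re-derived).
So the registered pair {stub 1, stub 2} is implied by... no: stub 2 is NOT implied by CSB; the pair is a
different (incomparable, and on the ℓ² side strictly weaker) sufficient condition than CSB. Recorded so
the lead can switch to the one-stub target CSB if a global ℓ² engine appears. -/
theorem massBoundAt_of_condOverlap (h : CondOverlap) : MassBoundAt (criticalProbI 3) ((11 : ℝ) / 4) := by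
  obtain ⟨C, hC⟩ := h
  refine ⟨Real.sqrt (27 * max C 0), fun n hn => ?_⟩
  have hcard : (#(box 3 n) : ℝ) ≤ 27 * (n : ℝ) ^ 3 := by
    have := card_annulus_le n n hn
    have h0 : #(box 3 n) ≤ #(box 3 n) := le_rfl
    rw [card_box]
    push_cast
    have h1' : (1 : ℝ) ≤ n := by exact_mod_cast hn
    have hr0 : (0 : ℝ) < n := by linarith
    nlinarith [h1', sq_nonneg ((n : ℝ) - 1), mul_pos hr0 hr0]
  exact shell_mass_le_of_overlap hn hcard (fun _ => measureReal_nonneg) (armProb_nonneg _ _) (hC n hn)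

/-! ## Checked sanity (Disproof §3 honoured): which side of criticality each stub uses

`stub_topShellOverlap` is FALSE with `p_c` replaced by `p = 1` (so, like the crux —
`tallClusterMassBound_false_without_criticality` — any proof of it must use `p ≤ p_c` quantitatively),
while `stub_wallArmLowerRegularity` is TRIVIALLY TRUE at `p = 1` (it is the `p ≥ p_c` input). -/

/-- At `p = 1` the wall arm is almost sure: `π_1(n) = 1`. -/
theorem armProb_one (n : ℕ) : armProb 1 n = 1 := by
  have h0 : (0 : V3) ∈ halfBox n := by
    simpa using cube_subset_halfBox n (up_mem_cube (Nat.zero_le n))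
  rw [← real_conn_zero_inter_arm 1 n]
  exact real_conn_inter_arm_one h0

/-- Stub 2's inequality holds at `p = 1` with `C = 1`, `λ = 0 < 11/4`: the regularity stub carries no
information above `p_c` — it is where `p ≥ p_c` enters the line. -/
theorem wallArmLowerRegularity_at_one :
    ∃ C lam : ℝ, lam < (11 : ℝ) / 4 ∧ ∀ n r : ℕ, 1 ≤ n → n ≤ r →
      armProb 1 n ≤ C * ((r : ℝ) / n) ^ lam * armProb 1 r := by
  refine ⟨1, 0, by norm_num, fun n r _ _ => ?_⟩
  simp [armProb_one, Real.rpow_zero]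

/-- The slab `{n/2 < x₀ ≤ n} × [-n, n]²` of the top shell (inside the half-box). -/
def topSlab (n : ℕ) : Finset V3 :=
  Fintype.piFinset fun i : Fin 3 => if i = 0 then Finset.Ioc ((n / 2 : ℕ) : ℤ) n else Finset.Icc (-(n : ℤ)) n

theorem mem_topSlab {n : ℕ} {x : V3} :
    x ∈ topSlab n ↔ (((n / 2 : ℕ) : ℤ) < x 0 ∧ x 0 ≤ n) ∧ (-(n : ℤ) ≤ x 1 ∧ x 1 ≤ n) ∧ (-(n : ℤ) ≤ x 2 ∧ x 2 ≤ n) := by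
  rw [topSlab, Fintype.mem_piFinset, forall_fin3]
  simp

/-- The slab lies in the top shell. -/
theorem topSlab_subset_annulus (n : ℕ) : topSlab n ⊆ annulus 3 (n / 2) n := by
  intro x hx
  obtain ⟨⟨h0a, h0b⟩, ⟨h1a, h1b⟩, ⟨h2a, h2b⟩⟩ := mem_topSlab.1 hx
  rw [mem_annulus, mem_box, mem_box, forall_fin3]
  refine ⟨⟨⟨by omega, h0b⟩, ⟨h1a, h1b⟩, ⟨h2a, h2b⟩⟩, fun h => ?_⟩
  have := (h 0).2
  push_cast at this
  omega

/-- The slab lies in the half-box `B_n ∩ ℍ`. -/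
theorem topSlab_subset_halfBox (n : ℕ) : topSlab n ⊆ halfBox n := by
  intro x hx
  obtain ⟨⟨h0a, h0b⟩, ⟨h1a, h1b⟩, ⟨h2a, h2b⟩⟩ := mem_topSlab.1 hx
  rw [halfBox, Finset.mem_filter, mem_box, forall_fin3]
  exact ⟨⟨⟨by omega, h0b⟩, ⟨h1a, h1b⟩, ⟨h2a, h2b⟩⟩, by omega⟩

/-- `|topSlab n| = (n - n/2) (2n+1)²`. -/
theorem card_topSlab (n : ℕ) : #(topSlab n) = (n - n / 2) * ((2 * n + 1) * (2 * n + 1)) := by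
  rw [topSlab, Fintype.card_piFinset, Fin.prod_univ_three]
  simp only [Fin.isValue, ↓reduceIte, Fin.one_eq_zero_iff, OfNat.ofNat_ne_one, Int.card_Ioc,
    show (2 : Fin 3) ≠ 0 from by decide, Int.card_Icc]
  have h1 : ((n : ℤ) - ((n / 2 : ℕ) : ℤ)).toNat = n - n / 2 := by omega
  have h2 : ((n : ℤ) + 1 - -(n : ℤ)).toNat = 2 * n + 1 := by omega
  rw [h1, h2, Nat.mul_assoc]

/-- `|topSlab n| ≥ n³` (as reals), for `n ≥ 1`. -/
theorem cube_le_card_topSlab {n : ℕ} (hn : 1 ≤ n) : (n : ℝ) ^ 3 ≤ (#(topSlab n) : ℝ) := by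
  rw [card_topSlab]
  have hsub : n / 2 ≤ n := Nat.div_le_self n 2
  have hhalf : 2 * (n - n / 2) ≥ n := by omega
  have hcast : ((n - n / 2 : ℕ) : ℝ) = (n : ℝ) - ((n / 2 : ℕ) : ℝ) := by
    rw [Nat.cast_sub hsub]
  have hhalf' : (n : ℝ) ≤ 2 * ((n - n / 2 : ℕ) : ℝ) := by exact_mod_cast hhalf
  push_cast
  have hn' : (1 : ℝ) ≤ n := by exact_mod_cast hn
  have hk0 : (0 : ℝ) ≤ ((n - n / 2 : ℕ) : ℝ) := by positivity
  nlinarith [hhalf', hn', hk0, mul_nonneg hk0 (by positivity : (0 : ℝ) ≤ (n : ℝ))]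

/-- **Stub 1 is false without criticality**: at `p = 1` every `x` of the slab is surely joined to `0` in `ℍ`
by an `n`-tall cluster (`real_conn_inter_arm_one`), so the top-shell overlap is `≥ n³` while `π_1(n) = 1`;
`n³ ≤ C n^{5/2}` fails for large `n`. (Compare `tallClusterMassBound_false_without_criticality`.) -/
theorem topShellOverlap_false_at_one :
    ¬ ∃ C : ℝ, ∀ n : ℕ, 1 ≤ n →
      ∑ x ∈ annulus 3 (n / 2) n, ((Pp 1).real (conn x ∩ arm n)) ^ 2
        ≤ C * (n : ℝ) ^ ((5 : ℝ) / 2) * (armProb 1 n) ^ 2 := by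
  rintro ⟨C, hC⟩
  refine not_forall_rpow_le (c := 1) (C := C) (s := (5 : ℝ) / 2) (t := 3) one_pos (by norm_num)
    fun n hn => ?_
  have h := hC n hn
  rw [armProb_one, one_pow, mul_one] at h
  have h3 : (n : ℝ) ^ (3 : ℝ) = (n : ℝ) ^ (3 : ℕ) := by exact_mod_cast Real.rpow_natCast (n : ℝ) 3
  have key : (n : ℝ) ^ (3 : ℕ) ≤ ∑ x ∈ annulus 3 (n / 2) n, ((Pp 1).real (conn x ∩ arm n)) ^ 2 := by
    calc (n : ℝ) ^ (3 : ℕ) ≤ (#(topSlab n) : ℝ) := cube_le_card_topSlab hn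
      _ = ∑ _x ∈ topSlab n, (1 : ℝ) := by simp
      _ = ∑ x ∈ topSlab n, ((Pp 1).real (conn x ∩ arm n)) ^ 2 := by
          refine Finset.sum_congr rfl fun x hx => ?_
          rw [real_conn_inter_arm_one (topSlab_subset_halfBox n hx), one_pow]
      _ ≤ ∑ x ∈ annulus 3 (n / 2) n, ((Pp 1).real (conn x ∩ arm n)) ^ 2 :=
          Finset.sum_le_sum_of_subset_of_nonneg (topSlab_subset_annulus n) fun _ _ _ => sq_nonneg _
  rw [one_mul, h3]
  exact key.trans h

/-! ## Gen-2 addenda (crux-plan gen 2, 2026-08-16; all PROVED, no new stub)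

Three pieces of exchange-rate bookkeeping for the lead, recorded as theorems so that nobody re-derives
them: (1) the DOUBLING CRITERION for stub 2 — a uniform per-dyadic-scale extension constant
`π_s(2n) ≥ q₀ π_s(n)` for `n ≥ n₀` with `q₀ > 2^{-11/4} ≈ 0.149` (MC: `0.51–0.59`, kit j007379) is
exactly what stub 2 needs, so ANY gluing argument with a per-scale loss better than `0.149` closes it;
(2) the WEAKEST regularity input the composition consumes (an averaged dyadic sum, gen-1 card
"minimal form"), proved sufficient; (3) the REGULARITY-FREE variant (T): if the top-shell overlap is
controlled at tallness `R` on every lower shell `n ≤ R` (normalised by `π_s(R)²`, not `π_s(n)²`), the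
crux follows with no wall-arm regularity at all — recorded with the warning that (T) hides the same
cross-scale (gluing-type) content inside its lower shells (`P(arm_R | 0 ↔_ℍ x) ≲ π_s(R)/π_s(n)` is
pinned quasi-multiplicativity), so it is an alternative battlefield, not a free lunch. -/

/-- Iterating a doubling bound: `q₀^k π(n) ≤ π(2^k n)` for `n ≥ n₀`. -/
theorem armProb_two_pow_mul_ge {p : unitInterval} {q₀ : ℝ} (hq0 : 0 ≤ q₀) {n₀ : ℕ}
    (h : ∀ n : ℕ, n₀ ≤ n → q₀ * armProb p n ≤ armProb p (2 * n)) :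
    ∀ k n : ℕ, n₀ ≤ n → q₀ ^ k * armProb p n ≤ armProb p (2 ^ k * n)
  | 0, n, _ => by simp
  | k + 1, n, hn => by
    have ih := armProb_two_pow_mul_ge hq0 h k n hn
    have hle : n₀ ≤ 2 ^ k * n := le_trans hn (Nat.le_mul_of_pos_left n (pow_pos (by norm_num) k))
    have hstep := h (2 ^ k * n) hle
    calc q₀ ^ (k + 1) * armProb p n = q₀ * (q₀ ^ k * armProb p n) := by ring
      _ ≤ q₀ * armProb p (2 ^ k * n) := mul_le_mul_of_nonneg_left ih hq0
      _ ≤ armProb p (2 * (2 ^ k * n)) := hstep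
      _ = armProb p (2 ^ (k + 1) * n) := by rw [pow_succ]; congr 1; ring

/-- `π_s` is non-increasing in the radius. -/
theorem armProb_antitone (p : unitInterval) {n r : ℕ} (h : n ≤ r) : armProb p r ≤ armProb p n :=
  measureReal_mono (arm_antitone h)

/-- **(1) DOUBLING CRITERION ⟹ STUB 2.** If for some `q₀ > 2^{-11/4}` and all `n ≥ n₀ ≥ 1` the wall
arm doubles its radius at conditional cost `≥ q₀`, i.e. `π_s(2n) ≥ q₀ π_s(n)` at `p_c(ℤ³)`, then the
two-scale lower regularity `stub_wallArmLowerRegularity` holds with `λ = log₂(1/q₀) < 11/4` and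
`C = (q₀ π_s(n₀))⁻¹`. (MC, kit j007379: `π_s(2n)/π_s(n) ∈ [0.51, 0.59]` for `n ≤ 48`, against the
threshold `2^{-11/4} ≈ 0.1487`.) The converse holds only for the geometric MEAN of the doubling ratios,
so this is the natural (slightly stronger, cleaner) target for whoever attacks stub 2. -/
theorem wallArmLowerRegularity_of_doubling {q₀ : ℝ} (hq : ((2 : ℝ) ^ ((11 : ℝ) / 4))⁻¹ < q₀)
    {n₀ : ℕ} (hn₀ : 1 ≤ n₀)
    (h : ∀ n : ℕ, n₀ ≤ n → q₀ * armProb (criticalProbI 3) n ≤ armProb (criticalProbI 3) (2 * n)) :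
    ∃ C lam : ℝ, lam < (11 : ℝ) / 4 ∧ ∀ n r : ℕ, 1 ≤ n → n ≤ r →
      armProb (criticalProbI 3) n ≤ C * ((r : ℝ) / n) ^ lam * armProb (criticalProbI 3) r := by
  set p : unitInterval := criticalProbI 3 with hp
  have h2pos : (0 : ℝ) < (2 : ℝ) ^ ((11 : ℝ) / 4) := by positivity
  have hq0 : 0 < q₀ := lt_trans (inv_pos.2 h2pos) hq
  have hπ0 : 0 < armProb p n₀ := armProb_criticalProbI_pos n₀
  -- q₀ ≤ 1, since π(2n₀) ≤ π(n₀)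
  have hq1 : q₀ ≤ 1 := by
    have h1 := h n₀ le_rfl
    have h2 : armProb p (2 * n₀) ≤ armProb p n₀ := armProb_antitone p (by omega)
    nlinarith
  set lam : ℝ := Real.logb 2 q₀⁻¹ with hlam
  have hqinv1 : 1 ≤ q₀⁻¹ := one_le_inv_iff₀.2 ⟨hq0, hq1⟩
  have hlam0 : 0 ≤ lam := Real.logb_nonneg (by norm_num) hqinv1
  have hlam_lt : lam < (11 : ℝ) / 4 := by
    rw [hlam, Real.logb_lt_iff_lt_rpow (by norm_num) (inv_pos.2 hq0)]
    rw [inv_lt_comm₀ hq0 h2pos]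
    exact hq
  have h2lam : (2 : ℝ) ^ lam = q₀⁻¹ := by
    rw [hlam, Real.rpow_logb (by norm_num) (by norm_num) (inv_pos.2 hq0)]
  -- the regular case n ≥ n₀
  have main : ∀ n r : ℕ, n₀ ≤ n → n ≤ r →
      armProb p n ≤ q₀⁻¹ * ((r : ℝ) / n) ^ lam * armProb p r := by
    intro n r hn hnr
    have hn1 : 1 ≤ n := le_trans hn₀ hn
    have hnpos : 0 < n := hn1
    have hn0r : (0 : ℝ) < n := by exact_mod_cast hn1
    set k : ℕ := Nat.log 2 (r / n) with hk
    have hq1' : 1 ≤ r / n := (Nat.le_div_iff_mul_le hnpos).2 (by simpa using hnr)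
    have hk1 : 2 ^ k ≤ r / n := Nat.pow_log_le_self 2 (by omega)
    have hk2 : r / n < 2 ^ (k + 1) := Nat.lt_pow_succ_log_self (by norm_num) _
    have hr_lt : r < 2 ^ (k + 1) * n := by
      have := (Nat.div_lt_iff_lt_mul hnpos).1 hk2
      linarith [Nat.mul_comm (2 ^ (k + 1)) n]
    -- π(r) ≥ π(2^{k+1} n) ≥ q₀^{k+1} π(n)
    have hchain : q₀ ^ (k + 1) * armProb p n ≤ armProb p r :=
      le_trans (armProb_two_pow_mul_ge hq0.le h (k + 1) n hn) (armProb_antitone p hr_lt.le)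
    -- (q₀⁻¹)^k = (2^k)^lam ≤ (r/n)^lam
    have hpowk : (q₀⁻¹) ^ k = ((2 : ℝ) ^ k) ^ lam := by
      rw [← h2lam, ← Real.rpow_natCast ((2 : ℝ) ^ lam) k, ← Real.rpow_mul (by norm_num),
        mul_comm, Real.rpow_mul (by norm_num), Real.rpow_natCast]
    have h2k_le : ((2 : ℝ) ^ k) ≤ (r : ℝ) / n := by
      have h1 : ((2 ^ k : ℕ) : ℝ) ≤ ((r / n : ℕ) : ℝ) := by exact_mod_cast hk1
      have h2 : ((r / n : ℕ) : ℝ) ≤ (r : ℝ) / n := Nat.cast_div_le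
      push_cast at h1
      exact h1.trans h2
    have hfac : (q₀⁻¹) ^ k ≤ ((r : ℝ) / n) ^ lam := by
      rw [hpowk]
      exact Real.rpow_le_rpow (by positivity) h2k_le hlam0
    have hπr := armProb_nonneg p r
    -- assemble
    have hqk0 : 0 < q₀ ^ (k + 1) := pow_pos hq0 _
    calc armProb p n = (q₀ ^ (k + 1))⁻¹ * (q₀ ^ (k + 1) * armProb p n) := by
          field_simp
      _ ≤ (q₀ ^ (k + 1))⁻¹ * armProb p r := mul_le_mul_of_nonneg_left hchain (by positivity)
      _ = q₀⁻¹ * (q₀⁻¹) ^ k * armProb p r := by rw [← inv_pow, pow_succ]; ring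
      _ ≤ q₀⁻¹ * ((r : ℝ) / n) ^ lam * armProb p r := by
          have hqi0 : 0 ≤ q₀⁻¹ := by positivity
          exact mul_le_mul_of_nonneg_right (mul_le_mul_of_nonneg_left hfac hqi0) hπr
  refine ⟨(q₀ * armProb p n₀)⁻¹, lam, hlam_lt, fun n r hn hnr => ?_⟩
  have hC : q₀⁻¹ ≤ (q₀ * armProb p n₀)⁻¹ := by
    rw [mul_inv]
    have : 1 ≤ (armProb p n₀)⁻¹ := one_le_inv_iff₀.2 ⟨hπ0, armProb_le_one p n₀⟩
    have hqi0 : 0 ≤ q₀⁻¹ := by positivity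
    nlinarith
  have hn0r : (0 : ℝ) < n := by exact_mod_cast hn
  have hrn1 : 1 ≤ (r : ℝ) / n := by
    rw [le_div_iff₀ hn0r, one_mul]; exact_mod_cast hnr
  have hfac1 : 1 ≤ ((r : ℝ) / n) ^ lam := Real.one_le_rpow hrn1 hlam0
  have hπr := armProb_nonneg p r
  rcases le_or_gt n₀ n with hn₀n | hnn₀
  · -- regular case
    calc armProb p n ≤ q₀⁻¹ * ((r : ℝ) / n) ^ lam * armProb p r := main n r hn₀n hnr
      _ ≤ (q₀ * armProb p n₀)⁻¹ * ((r : ℝ) / n) ^ lam * armProb p r := by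
          have h0 : 0 ≤ ((r : ℝ) / n) ^ lam * armProb p r := by positivity
          nlinarith [mul_le_mul_of_nonneg_right hC h0]
  · -- small n < n₀: π(n) ≤ 1 and π(r) is comparable to π(n₀)
    have hπn1 : armProb p n ≤ 1 := armProb_le_one p n
    rcases le_or_gt n₀ r with hn₀r | hrn₀
    · -- r ≥ n₀: use the regular case at (n₀, r) and r/n₀ ≤ r/n
      have hm := main n₀ r le_rfl hn₀r
      have hratio : ((r : ℝ) / n₀) ^ lam ≤ ((r : ℝ) / n) ^ lam := by
        refine Real.rpow_le_rpow (by positivity) ?_ hlam0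
        have hn₀r' : (0 : ℝ) < n₀ := by exact_mod_cast hn₀
        exact div_le_div_of_nonneg_left (by positivity) hn0r (by exact_mod_cast hnn₀.le)
      have hπn₀1 : armProb p n₀ ≤ 1 := armProb_le_one p n₀
      -- π(n) ≤ 1 = π(n₀)/π(n₀) ≤ …
      have key : armProb p n₀ ≤ q₀⁻¹ * ((r : ℝ) / n) ^ lam * armProb p r :=
        hm.trans (mul_le_mul_of_nonneg_right
          (mul_le_mul_of_nonneg_left hratio (by positivity)) hπr)
      have key2 : 1 ≤ (armProb p n₀)⁻¹ * (q₀⁻¹ * ((r : ℝ) / n) ^ lam * armProb p r) := by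
        rw [← inv_mul_cancel₀ hπ0.ne']
        exact mul_le_mul_of_nonneg_left key (by positivity)
      calc armProb p n ≤ 1 := hπn1
        _ ≤ (armProb p n₀)⁻¹ * (q₀⁻¹ * ((r : ℝ) / n) ^ lam * armProb p r) := key2
        _ = (q₀ * armProb p n₀)⁻¹ * ((r : ℝ) / n) ^ lam * armProb p r := by rw [mul_inv]; ring
    · -- r < n₀: π(r) ≥ π(n₀)
      have hπrn₀ : armProb p n₀ ≤ armProb p r := armProb_antitone p hrn₀.le
      have key2 : 1 ≤ (armProb p n₀)⁻¹ * armProb p r := by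
        rw [← inv_mul_cancel₀ hπ0.ne']
        exact mul_le_mul_of_nonneg_left hπrn₀ (by positivity)
      have hqi1 : 1 ≤ q₀⁻¹ := hqinv1
      calc armProb p n ≤ 1 := hπn1
        _ ≤ (armProb p n₀)⁻¹ * armProb p r := key2
        _ ≤ q₀⁻¹ * ((r : ℝ) / n) ^ lam * ((armProb p n₀)⁻¹ * armProb p r) := by
            have h0 : 0 ≤ (armProb p n₀)⁻¹ * armProb p r := by positivity
            have h1 : (1 : ℝ) ≤ q₀⁻¹ * ((r : ℝ) / n) ^ lam := one_le_mul_of_one_le_of_one_le hqi1 hfac1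
            simpa using mul_le_mul_of_nonneg_right h1 h0
        _ = (q₀ * armProb p n₀)⁻¹ * ((r : ℝ) / n) ^ lam * armProb p r := by rw [mul_inv]; ring

/-- **(2) THE WEAKEST REGULARITY INPUT THE COMPOSITION CONSUMES** (gen-1 card, "minimal form"): stub 1
together with the AVERAGED dyadic bound `Σ_{i<R} (R/2^i)^{11/4} π_s(R/2^i) ≤ C R^{11/4} π_s(R)` already
gives `MassBoundAt p_c (11/4)`. (Stub 2 implies this averaged bound by a geometric series; a prover who
only reaches an averaged cross-scale statement may discharge the line through this door.) -/
theorem massBoundAt_of_topShell_of_dyadicSum {CF CD : ℝ}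
    (hF : ∀ n : ℕ, 1 ≤ n →
      ∑ x ∈ annulus 3 (n / 2) n, ((Pp (criticalProbI 3)).real (conn x ∩ arm n)) ^ 2
        ≤ CF * (n : ℝ) ^ ((5 : ℝ) / 2) * (armProb (criticalProbI 3) n) ^ 2)
    (hD : ∀ R : ℕ, 1 ≤ R →
      ∑ i ∈ Finset.range R, ((R / 2 ^ i : ℕ) : ℝ) ^ ((11 : ℝ) / 4) * armProb (criticalProbI 3) (R / 2 ^ i)
        ≤ CD * (R : ℝ) ^ ((11 : ℝ) / 4) * armProb (criticalProbI 3) R) :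
    MassBoundAt (criticalProbI 3) ((11 : ℝ) / 4) := by
  set p : unitInterval := criticalProbI 3 with hp
  set K : ℝ := Real.sqrt (27 * max CF 0) with hK
  have hK0 : 0 ≤ K := Real.sqrt_nonneg _
  refine ⟨1 + K * max CD 0, fun R hR => ?_⟩
  have hR0 : (0 : ℝ) < R := by exact_mod_cast hR
  have hπR := armProb_nonneg p R
  -- shell i is bounded by K n_i^{11/4} π(n_i), n_i = R / 2^i (and by 0 if n_i = 0)
  have shell : ∀ i : ℕ, ∑ x ∈ annulus 3 (R / 2 ^ (i + 1)) (R / 2 ^ i), (Pp p).real (conn x ∩ arm R)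
      ≤ K * (((R / 2 ^ i : ℕ) : ℝ) ^ ((11 : ℝ) / 4) * armProb p (R / 2 ^ i)) := by
    intro i
    set n : ℕ := R / 2 ^ i with hn
    rcases Nat.eq_zero_or_pos n with hn0 | hnpos
    · have hn1 : R / 2 ^ (i + 1) = 0 := by rw [← div_two_pow_succ, ← hn, hn0]
      rw [hn1, hn0]
      simp only [annulus, sdiff_self, Finset.bot_eq_empty, Finset.sum_empty]
      exact mul_nonneg hK0 (mul_nonneg (by positivity) (armProb_nonneg p 0))
    · have hn1 : 1 ≤ n := hnpos
      have hnR : n ≤ R := Nat.div_le_self _ _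
      have hπn := armProb_nonneg p n
      have step1 : ∑ x ∈ annulus 3 (R / 2 ^ (i + 1)) (R / 2 ^ i), (Pp p).real (conn x ∩ arm R)
          ≤ ∑ x ∈ annulus 3 (n / 2) n, (Pp p).real (conn x ∩ arm n) := by
        rw [← div_two_pow_succ, ← hn]
        exact Finset.sum_le_sum fun x _ => real_conn_inter_arm_mono p x hnR
      have step2 : ∑ x ∈ annulus 3 (n / 2) n, (Pp p).real (conn x ∩ arm n)
          ≤ K * (n : ℝ) ^ ((11 : ℝ) / 4) * armProb p n :=
        shell_mass_le_of_overlap hn1 (card_annulus_le _ _ hn1) (fun _ => measureReal_nonneg) hπn (hF n hn1)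
      calc _ ≤ K * (n : ℝ) ^ ((11 : ℝ) / 4) * armProb p n := step1.trans step2
        _ = K * ((n : ℝ) ^ ((11 : ℝ) / 4) * armProb p n) := by ring
  have hmass : mass p R = (Pp p).real (conn 0 ∩ arm R) +
      ∑ i ∈ Finset.range R, ∑ x ∈ annulus 3 (R / 2 ^ (i + 1)) (R / 2 ^ i), (Pp p).real (conn x ∩ arm R) :=
    sum_box_eq_root_add_shells (fun x => (Pp p).real (conn x ∩ arm R)) R
  have hroot : (Pp p).real (conn 0 ∩ arm R) = armProb p R := real_conn_zero_inter_arm p R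
  have hRpow1 : (1 : ℝ) ≤ (R : ℝ) ^ ((11 : ℝ) / 4) := Real.one_le_rpow (by exact_mod_cast hR) (by norm_num)
  have hX0 : 0 ≤ (R : ℝ) ^ ((11 : ℝ) / 4) * armProb p R := by positivity
  have hDR := hD R hR
  have hD' : ∑ i ∈ Finset.range R, ((R / 2 ^ i : ℕ) : ℝ) ^ ((11 : ℝ) / 4) * armProb p (R / 2 ^ i)
      ≤ max CD 0 * ((R : ℝ) ^ ((11 : ℝ) / 4) * armProb p R) := by
    refine hDR.trans ?_
    calc CD * (R : ℝ) ^ ((11 : ℝ) / 4) * armProb p R = CD * ((R : ℝ) ^ ((11 : ℝ) / 4) * armProb p R) := by ring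
      _ ≤ max CD 0 * ((R : ℝ) ^ ((11 : ℝ) / 4) * armProb p R) := mul_le_mul_of_nonneg_right (le_max_left _ _) hX0
  calc mass p R
      = armProb p R + ∑ i ∈ Finset.range R,
          ∑ x ∈ annulus 3 (R / 2 ^ (i + 1)) (R / 2 ^ i), (Pp p).real (conn x ∩ arm R) := by rw [hmass, hroot]
    _ ≤ armProb p R + ∑ i ∈ Finset.range R,
          K * (((R / 2 ^ i : ℕ) : ℝ) ^ ((11 : ℝ) / 4) * armProb p (R / 2 ^ i)) :=
        add_le_add le_rfl (Finset.sum_le_sum fun i _ => shell i)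
    _ = armProb p R + K * ∑ i ∈ Finset.range R,
          ((R / 2 ^ i : ℕ) : ℝ) ^ ((11 : ℝ) / 4) * armProb p (R / 2 ^ i) := by rw [Finset.mul_sum]
    _ ≤ (R : ℝ) ^ ((11 : ℝ) / 4) * armProb p R + K * (max CD 0 * ((R : ℝ) ^ ((11 : ℝ) / 4) * armProb p R)) := by
        refine add_le_add ?_ (mul_le_mul_of_nonneg_left hD' hK0)
        simpa using mul_le_mul_of_nonneg_right hRpow1 hπR
    _ = (1 + K * max CD 0) * (R : ℝ) ^ ((11 : ℝ) / 4) * armProb p R := by ring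

/-- (T), the REGULARITY-FREE two-scale variant of stub 1: the overlap of two independent R-TALL wall
clusters on the shell of radius `n ≤ R` is `≤ C n^{5/2} π_s(R)²` (normalised at tallness `R`).
Heuristic value `n^{3-2x_h} π_s(R)²` (conditional density `n^{-x_h}` at scale `n`, independent of `R`),
same margin `0.45` at every scale; no root term; false at `p = 1`. It implies stub 1 (`n = R`) and CSB,
and it implies the crux ALONE (`massBoundAt_of_twoScaleShellOverlap`) — but its lower shells contain
pinned upper quasi-multiplicativity `P(0 ↔_ℍ x, arm_R) ≲ P(0 ↔_ℍ x) π_s(R)/π_s(n)`, i.e. the same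
cross-scale (gluing-type) content that stub 2 isolates; recorded as the lead's reshape option (T),
not registered (a one-stub line would be a bare transfer). [folklore] -/
def TwoScaleShellOverlap : Prop :=
  ∃ C : ℝ, ∀ n R : ℕ, 1 ≤ n → n ≤ R →
    ∑ x ∈ annulus 3 (n / 2) n, ((Pp (criticalProbI 3)).real (conn x ∩ arm R)) ^ 2
      ≤ C * (n : ℝ) ^ ((5 : ℝ) / 2) * (armProb (criticalProbI 3) R) ^ 2

/-- (T) ⟹ stub 1 (take `n = R`). -/
theorem topShellOverlap_of_twoScaleShellOverlap (h : TwoScaleShellOverlap) :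
    ∃ C : ℝ, ∀ n : ℕ, 1 ≤ n →
      ∑ x ∈ annulus 3 (n / 2) n, ((Pp (criticalProbI 3)).real (conn x ∩ arm n)) ^ 2
        ≤ C * (n : ℝ) ^ ((5 : ℝ) / 2) * (armProb (criticalProbI 3) n) ^ 2 := by
  obtain ⟨C, hC⟩ := h
  exact ⟨C, fun n hn => hC n n hn le_rfl⟩

/-- **(3) (T) ALONE ⟹ the crux** (`MassBoundAt p_c (11/4)`), with no wall-arm regularity: on shell
`n = R/2^i`, Cauchy–Schwarz gives `≤ √(27C) n^{11/4} π_s(R) ≤ √(27C) 2^{-11i/4} R^{11/4} π_s(R)`;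
sum the geometric series. -/
theorem massBoundAt_of_twoScaleShellOverlap (h : TwoScaleShellOverlap) :
    MassBoundAt (criticalProbI 3) ((11 : ℝ) / 4) := by
  obtain ⟨CF, hF⟩ := h
  set p : unitInterval := criticalProbI 3 with hp
  set K : ℝ := Real.sqrt (27 * max CF 0) with hK
  set δ : ℝ := (11 : ℝ) / 4 with hδdef
  have hδ : 0 < δ := by rw [hδdef]; norm_num
  set q : ℝ := ((2 : ℝ) ^ δ)⁻¹ with hq
  have hq1 : q < 1 := inv_lt_one_of_one_lt₀ (Real.one_lt_rpow (by norm_num) hδ)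
  have hq0 : 0 ≤ q := by positivity
  have hK0 : 0 ≤ K := Real.sqrt_nonneg _
  refine ⟨1 + K * (1 - q)⁻¹, fun R hR => ?_⟩
  have hR0 : (0 : ℝ) < R := by exact_mod_cast hR
  have hπR := armProb_nonneg p R
  have shell : ∀ i : ℕ, ∑ x ∈ annulus 3 (R / 2 ^ (i + 1)) (R / 2 ^ i), (Pp p).real (conn x ∩ arm R)
      ≤ K * q ^ i * ((R : ℝ) ^ ((11 : ℝ) / 4) * armProb p R) := by
    intro i
    set n : ℕ := R / 2 ^ i with hn
    have hrhs0 : 0 ≤ K * q ^ i * ((R : ℝ) ^ ((11 : ℝ) / 4) * armProb p R) := by positivity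
    rcases Nat.eq_zero_or_pos n with hn0 | hnpos
    · have hn1 : R / 2 ^ (i + 1) = 0 := by rw [← div_two_pow_succ, ← hn, hn0]
      rw [hn1, hn0]
      simp only [annulus, sdiff_self, Finset.bot_eq_empty, Finset.sum_empty]
      exact hrhs0
    · have hn1 : 1 ≤ n := hnpos
      have hnR : n ≤ R := Nat.div_le_self _ _
      have hn0r : (0 : ℝ) < n := by exact_mod_cast hn1
      have step2 : ∑ x ∈ annulus 3 (n / 2) n, (Pp p).real (conn x ∩ arm R)
          ≤ K * (n : ℝ) ^ ((11 : ℝ) / 4) * armProb p R :=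
        shell_mass_le_of_overlap hn1 (card_annulus_le _ _ hn1) (fun _ => measureReal_nonneg) hπR
          (hF n R hn1 hnR)
      have hsf : ((n : ℝ) / R) ^ δ ≤ q ^ i := by
        have := scale_factor_le (i := i) hδ.le hR
        rwa [← hn] at this
      have hpow : (n : ℝ) ^ ((11 : ℝ) / 4) = ((n : ℝ) / R) ^ δ * (R : ℝ) ^ ((11 : ℝ) / 4) := by
        rw [hδdef, Real.div_rpow hn0r.le hR0.le, div_mul_cancel₀]
        exact (Real.rpow_pos_of_pos hR0 _).ne'
      rw [← div_two_pow_succ, ← hn]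
      calc ∑ x ∈ annulus 3 (n / 2) n, (Pp p).real (conn x ∩ arm R)
          ≤ K * (n : ℝ) ^ ((11 : ℝ) / 4) * armProb p R := step2
        _ = K * (((n : ℝ) / R) ^ δ * (R : ℝ) ^ ((11 : ℝ) / 4)) * armProb p R := by rw [hpow]
        _ ≤ K * (q ^ i * (R : ℝ) ^ ((11 : ℝ) / 4)) * armProb p R := by
            have hRp : 0 ≤ (R : ℝ) ^ ((11 : ℝ) / 4) := by positivity
            exact mul_le_mul_of_nonneg_right
              (mul_le_mul_of_nonneg_left (mul_le_mul_of_nonneg_right hsf hRp) hK0) hπR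
        _ = K * q ^ i * ((R : ℝ) ^ ((11 : ℝ) / 4) * armProb p R) := by ring
  have geom : ∑ i ∈ Finset.range R, q ^ i ≤ (1 - q)⁻¹ := by
    have hs : Summable fun i : ℕ => q ^ i := summable_geometric_of_lt_one hq0 hq1
    calc ∑ i ∈ Finset.range R, q ^ i ≤ ∑' i : ℕ, q ^ i :=
          hs.sum_le_tsum (Finset.range R) fun i _ => pow_nonneg hq0 i
      _ = (1 - q)⁻¹ := tsum_geometric_of_lt_one hq0 hq1
  have hmass : mass p R = (Pp p).real (conn 0 ∩ arm R) +
      ∑ i ∈ Finset.range R, ∑ x ∈ annulus 3 (R / 2 ^ (i + 1)) (R / 2 ^ i), (Pp p).real (conn x ∩ arm R) :=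
    sum_box_eq_root_add_shells (fun x => (Pp p).real (conn x ∩ arm R)) R
  have hroot : (Pp p).real (conn 0 ∩ arm R) = armProb p R := real_conn_zero_inter_arm p R
  have hRpow1 : (1 : ℝ) ≤ (R : ℝ) ^ ((11 : ℝ) / 4) := Real.one_le_rpow (by exact_mod_cast hR) (by norm_num)
  have hX0 : 0 ≤ (R : ℝ) ^ ((11 : ℝ) / 4) * armProb p R := by positivity
  calc mass p R
      = armProb p R + ∑ i ∈ Finset.range R,
          ∑ x ∈ annulus 3 (R / 2 ^ (i + 1)) (R / 2 ^ i), (Pp p).real (conn x ∩ arm R) := by rw [hmass, hroot]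
    _ ≤ armProb p R + ∑ i ∈ Finset.range R, K * q ^ i * ((R : ℝ) ^ ((11 : ℝ) / 4) * armProb p R) :=
        add_le_add le_rfl (Finset.sum_le_sum fun i _ => shell i)
    _ = armProb p R + K * (∑ i ∈ Finset.range R, q ^ i) * ((R : ℝ) ^ ((11 : ℝ) / 4) * armProb p R) := by
        rw [Finset.mul_sum, Finset.sum_mul]
    _ ≤ (R : ℝ) ^ ((11 : ℝ) / 4) * armProb p R
          + K * (1 - q)⁻¹ * ((R : ℝ) ^ ((11 : ℝ) / 4) * armProb p R) := by
        refine add_le_add ?_ ?_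
        · simpa using mul_le_mul_of_nonneg_right hRpow1 hπR
        · exact mul_le_mul_of_nonneg_right (mul_le_mul_of_nonneg_left geom hK0) hX0
    _ = (1 + K * (1 - q)⁻¹) * (R : ℝ) ^ ((11 : ℝ) / 4) * armProb p R := by ring

/-- (T) is false without criticality too (its `n = R` instance is stub 1 at `p ↦ 1`): recorded so a
disprover's `-- Targets` entry can point at the same slab witness. -/
theorem twoScaleShellOverlap_false_at_one :
    ¬ ∃ C : ℝ, ∀ n R : ℕ, 1 ≤ n → n ≤ R →
      ∑ x ∈ annulus 3 (n / 2) n, ((Pp 1).real (conn x ∩ arm R)) ^ 2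
        ≤ C * (n : ℝ) ^ ((5 : ℝ) / 2) * (armProb 1 R) ^ 2 := by
  rintro ⟨C, hC⟩
  exact topShellOverlap_false_at_one ⟨C, fun n hn => hC n n hn le_rfl⟩


end Summit.CriticalPhenomena.PercolationContinuityZ3.Cruxes.TallClusterMassBound.ReplicaOverlapCsTransfer
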